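import Summits.BirchSwinnertonDyer.Rank1Residual.Additive.SplitMultiplicativeWitnessOfTamagawa
import HarnessLib

/-!
# Tamagawa persistence at a SPLIT multiplicative prime: `c_𝔭(V ⊗ K) = e(𝔭|v) · c_v(V)`
# (cell `b2b-bsdres`, team n1011, seat p16 GEN 5 draft, filed by p16 GEN 6; rider to n1011-p01's row
# T-L1-KN file `SplitMultiplicativeWitnessOfTamagawa`; customer = p01's row T-MIL-ODD, 'WANTED → p16'
# 2026-08-21T16:33Z, lead R5-68: support file DEALT → p16, one producer per theorem)

HONEST FRAMING (cell `b2b-bsdres`, run/shared/lean/b2b/bsd-rank1-residual/, verbatim in every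
file): the goal of the cell is to DELETE the COMBINATION-SHAPED residual classes of the
Birch–Swinnerton-Dyer formula for ALL analytic-rank `≤ 1` elliptic curves over `ℚ` — "full BSD
formula for every rank `≤ 1` curve in class `C`" assembled STRICTLY from published theorems — so
that the rank-`≤ 1` remainder becomes exactly the CONSTRUCTION-SHAPED classes, which are TYPED
(missing-input `Prop`s), NOT attempted. This is not "finishing BSD". Team n1011 (N10 / N11, the
Route-G budget node): research route; no claim beyond the stated classes; nothing is booked; marks
UNCHANGED. Theorems only: no definition, no named fact, no `sorry`.

## What

For `V/ℚ` globally minimal with SPLIT multiplicative reduction at the place `v`, `K` any number field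
and `𝔭` any place of `K` above `v`:

* `hasSplitMultiplicativeReductionAt_baseChange_of_hasSplitMultiplicativeReductionAt` — `V ⊗ K` has
  split multiplicative reduction at `𝔭` (place-indexed reading of FILE 6's
  `hasSplitMultiplicativeReductionAt_baseChange_of_hasSplitMultiplicativeReductionAtPrime`);
* `localTamagawaNumber_baseChange_eq_ramificationIdx_mul_of_hasSplitMultiplicativeReductionAt` —
  **`c_𝔭(V ⊗ K) = e(𝔭|v) · c_v(V)`**: `c = ord Δ_min` at a split place on both sides (Silverman
  *ATAEC* Cor. IV.9.2 (d); tree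
  `localTamagawaNumber_eq_ordMinimalDiscriminant_of_hasSplitMultiplicativeReductionAt`) and
  `ord_𝔭 Δ_min(V ⊗ K) = e(𝔭|v) · ord_v Δ_min(V)` (n1011-p01's
  `ordMinimalDiscriminant_baseChange_eq_mul_of_hasSplitMultiplicativeReductionAt`);
* `localTamagawaNumber_dvd_localTamagawaNumber_baseChange_of_hasSplitMultiplicativeReductionAt` —
  hence `c_v(V) ∣ c_𝔭(V ⊗ K)`, in particular `p ∣ c_v ⇒ p ∣ c_𝔭` at every layer of a tower.

(At ADDITIVE places there is no such persistence — `KodairaSymbolUnramifiedBaseChange`; at NON-split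
multiplicative places `c ∈ {1, 2}` and splitting may be acquired in `K`.)
References: J. H. Silverman, *ATAEC*, Cor. IV.9.2 (d); *AEC*, VII.1 Prop. 1.3, VII.5 Prop. 5.1.
-/

noncomputable section

open scoped Classical NumberField

open WeierstrassCurve NumberField IsDedekindDomain Rat.HeightOneSpectrum
  Literature.NumberTheory.EllipticCurves Literature.NumberTheory.EllipticCurves.Rank1Residual

namespace Summit.BirchSwinnertonDyer.Rank1Residual.Additive

variable (V : WeierstrassCurve ℚ) [V.IsElliptic] [V.IsGloballyMinimal]
  {v : HeightOneSpectrum (𝓞 ℚ)} {K : Type} [Field K] [NumberField K] (𝔭 : HeightOneSpectrum (𝓞 K))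

/-- **Split multiplicative reduction persists above `v`** (place-indexed form of FILE 6's
`hasSplitMultiplicativeReductionAt_baseChange_of_hasSplitMultiplicativeReductionAtPrime`): for `V/ℚ`
globally minimal, split multiplicative at the place `v`, `K` a number field and `𝔭` a place of `K`
above `v`, `V ⊗ K` is split multiplicative at `𝔭`. [cite: SilvermanAEC2009, VII.5 Prop. 5.1(b) and VII.1 Prop. 1.3(b)] -/
theorem hasSplitMultiplicativeReductionAt_baseChange_of_hasSplitMultiplicativeReductionAt
    (hsplit : V.HasSplitMultiplicativeReductionAt v) (h𝔭 : 𝔭.asIdeal.under (𝓞 ℚ) = v.asIdeal) :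
    (V.baseChange K).HasSplitMultiplicativeReductionAt 𝔭 := by
  haveI : Fact (primesEquiv v : ℕ).Prime := ⟨(primesEquiv v).2⟩
  exact hasSplitMultiplicativeReductionAt_baseChange_of_hasSplitMultiplicativeReductionAtPrime V
    (primesEquiv v : ℕ) 𝔭 (natCast_primesEquiv_mem_of_under_eq 𝔭 h𝔭)
    ((hasSplitMultiplicativeReductionAtPrime_iff_hasSplitMultiplicativeReductionAt V v).mpr hsplit)

/-- **Tamagawa persistence at a split multiplicative prime: `c_𝔭(V ⊗ K) = e(𝔭|v) · c_v(V)`.** For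
`V/ℚ` globally minimal, split multiplicative at the place `v`, `K` ANY number field and `𝔭` any place
of `K` above `v`: `c = ord Δ_min` at a split multiplicative place on both sides (Silverman *ATAEC*
Cor. IV.9.2 (d)), and `ord_𝔭 Δ_min(V ⊗ K) = e(𝔭|v) · ord_v Δ_min(V)` (n1011-p01's
`ordMinimalDiscriminant_baseChange_eq_mul_of_hasSplitMultiplicativeReductionAt`).
[cite: SilvermanATAEC1994, Cor. IV.9.2(d)] [cite: SilvermanAEC2009, VII.1 Prop. 1.3(b)] -/
theorem localTamagawaNumber_baseChange_eq_ramificationIdx_mul_of_hasSplitMultiplicativeReductionAt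
    (hsplit : V.HasSplitMultiplicativeReductionAt v) (h𝔭 : 𝔭.asIdeal.under (𝓞 ℚ) = v.asIdeal) :
    ((V.baseChange K).baseChange (𝔭.adicCompletion K)).localTamagawaNumber
        (𝔭.adicCompletionIntegers K) =
      v.asIdeal.ramificationIdx' 𝔭.asIdeal *
        (V.baseChange (v.adicCompletion ℚ)).localTamagawaNumber (v.adicCompletionIntegers ℚ) := by
  haveI : (V.baseChange K).IsElliptic := by rw [baseChange]; infer_instance
  rw [localTamagawaNumber_eq_ordMinimalDiscriminant_of_hasSplitMultiplicativeReductionAt 𝔭 _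
      (hasSplitMultiplicativeReductionAt_baseChange_of_hasSplitMultiplicativeReductionAt V 𝔭 hsplit h𝔭),
    localTamagawaNumber_eq_ordMinimalDiscriminant_of_hasSplitMultiplicativeReductionAt v V hsplit,
    ordMinimalDiscriminant_baseChange_eq_mul_of_hasSplitMultiplicativeReductionAt V 𝔭 hsplit h𝔭]

/-- Hence **`c_v(V) ∣ c_𝔭(V ⊗ K)`** at a split multiplicative `v` (so a census datum `p ∣ c_v` over
`ℚ` persists at every place above `v` of every layer of a tower). [cite: SilvermanATAEC1994, Cor. IV.9.2(d)] -/
theorem localTamagawaNumber_dvd_localTamagawaNumber_baseChange_of_hasSplitMultiplicativeReductionAt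
    (hsplit : V.HasSplitMultiplicativeReductionAt v) (h𝔭 : 𝔭.asIdeal.under (𝓞 ℚ) = v.asIdeal) :
    (V.baseChange (v.adicCompletion ℚ)).localTamagawaNumber (v.adicCompletionIntegers ℚ) ∣
      ((V.baseChange K).baseChange (𝔭.adicCompletion K)).localTamagawaNumber
        (𝔭.adicCompletionIntegers K) :=
  Dvd.intro_left _
    (localTamagawaNumber_baseChange_eq_ramificationIdx_mul_of_hasSplitMultiplicativeReductionAt V 𝔭
      hsplit h𝔭).symm

end Summit.BirchSwinnertonDyer.Rank1Residual.Additive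

end
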